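import Mathlib
import Literature.AlgebraicGeometry.HyperbolicPolynomials.SpectrahedralShadow
import HarnessLib

/-!
# Calculus of spectrahedral shadows (lifted LMI representations)

Topic `Literature/AlgebraicGeometry/HyperbolicPolynomials`, companion of `SpectrahedralShadow.lean`
(`IsSpectrahedralShadow K`: `K = {x | ∃ y, A(x,y) + B ⪰ 0}` for a real-linear pencil `A` into
`m × m` real matrices). The closure properties used in Netzer–Sanyal's proof of their Thm 1.1
(fact `NetzerSanyal2014_thm11`), all PROVED; no named facts.

## Main results (namespace `Literature.AlgebraicGeometry.HyperbolicPolynomials`)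

* `isSpectrahedralShadow_of_rep` — presentations with an arbitrary finite index type and an
  arbitrary finite-dimensional lifting space suffice; `isSpectrahedralShadow_of_rep_constraints` —
  an LMI together with finitely many affine inequalities and equalities (as `1 × 1` blocks);
  `posSemidef_fromBlocks_zero_iff` (block-diagonal LMIs).
* `eq_zero_of_posSemidef_of_isBounded` — a bounded non-empty presented set has no recession
  direction: `A(x,y) ⪰ 0 ⇒ x = 0` (the exactness mechanism of Helton–Nie 2009, Thm 2.2).
* `IsSpectrahedralShadow.inter`, `.affine_preimage`, `.affine_image`, `.image`, `.vadd`,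
  `isSpectrahedralShadow_empty`, `isSpectrahedralShadow_singleton`.
* `IsSpectrahedralShadow.coneOver` — the **conical hull** `{t s : t ≥ 0, s ∈ S}` of a bounded
  non-empty shadow `S` inside a hyperplane `{c = 1}` (Netzer–Sinn 2009, Prop. 2.1;
  Netzer–Sanyal, proof of Thm 1.1: "taking the conical hull retains the property of being a
  spectrahedral shadow").
* `IsSpectrahedralShadow.convexHull_union`, `.convexHull_biUnion` — the **convex hull of a finite
  union** of bounded convex non-empty shadows (Helton–Nie 2009, Thm 2.2; used by Netzer–Sanyal in
  the proof of Thm 3.1).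

## References

* [HeltonNie2009] J. W. Helton, J. Nie, *Sufficient and necessary conditions for semidefinite
  representability of convex hulls and sets*, SIAM J. Optim. 20 (2009) 759–791 (arXiv:0709.4017):
  §2, Theorem 2.2 (convex hull of SDP representable sets; exact for bounded sets).
* [NetzerSinn2009] T. Netzer, R. Sinn, *A note on the convex hull of finitely many projections of
  spectrahedra*, arXiv:0908.3386: Proposition 2.1 (conical hull).
* [NetzerSanyal2014] T. Netzer, R. Sanyal, Math. Program. 153 (2015), §3 (where both are used).
-/

noncomputable section

open Matrix Set
open scoped BigOperators Matrix

namespace Literature.AlgebraicGeometry.HyperbolicPolynomials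

/-! ### Block-diagonal linear matrix inequalities -/

section Blocks

variable {m₁ m₂ : Type*}

/-- [folklore] -/
theorem fromBlocks_submatrix_inl (A : Matrix m₁ m₁ ℝ) (B : Matrix m₁ m₂ ℝ) (C : Matrix m₂ m₁ ℝ)
    (D : Matrix m₂ m₂ ℝ) : (fromBlocks A B C D).submatrix Sum.inl Sum.inl = A := by
  ext i j; simp

/-- [folklore] -/
theorem fromBlocks_submatrix_inr (A : Matrix m₁ m₁ ℝ) (B : Matrix m₁ m₂ ℝ) (C : Matrix m₂ m₁ ℝ)
    (D : Matrix m₂ m₂ ℝ) : (fromBlocks A B C D).submatrix Sum.inr Sum.inr = D := by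
  ext i j; simp

/-- A block-diagonal real matrix is positive semidefinite iff its diagonal blocks are.
[folklore] -/
theorem posSemidef_fromBlocks_zero_iff [Fintype m₁] [Fintype m₂] {M₁ : Matrix m₁ m₁ ℝ}
    {M₂ : Matrix m₂ m₂ ℝ} :
    (fromBlocks M₁ 0 0 M₂).PosSemidef ↔ M₁.PosSemidef ∧ M₂.PosSemidef := by
  constructor
  · intro h
    exact ⟨by simpa [fromBlocks_submatrix_inl] using h.submatrix Sum.inl,
      by simpa [fromBlocks_submatrix_inr] using h.submatrix Sum.inr⟩
  · rintro ⟨h₁, h₂⟩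
    refine PosSemidef.of_dotProduct_mulVec_nonneg
      (IsHermitian.fromBlocks h₁.isHermitian (by simp) h₂.isHermitian) fun v => ?_
    have hv : v = Sum.elim (v ∘ Sum.inl) (v ∘ Sum.inr) := (Sum.elim_comp_inl_inr v).symm
    rw [star_trivial, hv, fromBlocks_mulVec, sumElim_dotProduct_sumElim]
    simp only [Sum.elim_comp_inl, Sum.elim_comp_inr, zero_mulVec, add_zero, zero_add]
    have e₁ := h₁.dotProduct_mulVec_nonneg (v ∘ Sum.inl)
    have e₂ := h₂.dotProduct_mulVec_nonneg (v ∘ Sum.inr)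
    rw [star_trivial] at e₁ e₂
    exact add_nonneg e₁ e₂

variable {W : Type*} [AddCommGroup W] [Module ℝ W]

/-- The block-diagonal combination of two linear matrix pencils. [folklore] -/
def blockDiagLin (A₁ : W →ₗ[ℝ] Matrix m₁ m₁ ℝ) (A₂ : W →ₗ[ℝ] Matrix m₂ m₂ ℝ) :
    W →ₗ[ℝ] Matrix (m₁ ⊕ m₂) (m₁ ⊕ m₂) ℝ where
  toFun w := fromBlocks (A₁ w) 0 0 (A₂ w)
  map_add' v w := by simp only [map_add, fromBlocks_add, add_zero]
  map_smul' c w := by simp only [map_smul, RingHom.id_apply, fromBlocks_smul, smul_zero]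

/-- [folklore] -/
@[simp] theorem blockDiagLin_apply (A₁ : W →ₗ[ℝ] Matrix m₁ m₁ ℝ) (A₂ : W →ₗ[ℝ] Matrix m₂ m₂ ℝ)
    (w : W) : blockDiagLin A₁ A₂ w = fromBlocks (A₁ w) 0 0 (A₂ w) := rfl

/-- `Sum.elim` of two linear maps into function spaces. [folklore] -/
def sumElimLin {κ₁ κ₂ : Type*} (f : W →ₗ[ℝ] (κ₁ → ℝ)) (g : W →ₗ[ℝ] (κ₂ → ℝ)) :
    W →ₗ[ℝ] (κ₁ ⊕ κ₂ → ℝ) where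
  toFun w := Sum.elim (f w) (g w)
  map_add' v w := by
    funext k; rcases k with k | k <;> simp
  map_smul' c w := by
    funext k; rcases k with k | k <;> simp

/-- `Matrix.diagonal` after a linear map. [folklore] -/
def diagLin {κ : Type*} [DecidableEq κ] (L : W →ₗ[ℝ] (κ → ℝ)) : W →ₗ[ℝ] Matrix κ κ ℝ where
  toFun w := diagonal (L w)
  map_add' v w := by rw [map_add]; exact (diagonal_add (L v) (L w)).symm
  map_smul' c w := by rw [map_smul, RingHom.id_apply]; exact diagonal_smul c (L w)

/-- [folklore] -/
@[simp] theorem diagLin_apply {κ : Type*} [DecidableEq κ] (L : W →ₗ[ℝ] (κ → ℝ)) (w : W) :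
    diagLin L w = diagonal (L w) := rfl

/-- [folklore] -/
@[simp] theorem sumElimLin_apply {κ₁ κ₂ : Type*} (f : W →ₗ[ℝ] (κ₁ → ℝ)) (g : W →ₗ[ℝ] (κ₂ → ℝ))
    (w : W) : sumElimLin f g w = Sum.elim (f w) (g w) := rfl

end Blocks

/-! ### Presentations with arbitrary finite index type and lifting space -/

section Rep

variable {σ : Type*}

/-- A lifted LMI description with any finite index type and any finite-dimensional lifting space
gives a spectrahedral shadow (reindex and choose coordinates). [folklore] -/
theorem isSpectrahedralShadow_of_rep {ι V : Type*} [Fintype ι] [AddCommGroup V] [Module ℝ V]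
    [Module.Finite ℝ V] {K : Set (σ → ℝ)} (A : ((σ → ℝ) × V) →ₗ[ℝ] Matrix ι ι ℝ)
    (B : Matrix ι ι ℝ) (h : ∀ x, x ∈ K ↔ ∃ y : V, (A (x, y) + B).PosSemidef) :
    IsSpectrahedralShadow K := by
  classical
  set eι := Fintype.equivFin ι with heι
  set eV : V ≃ₗ[ℝ] (Fin (Module.finrank ℝ V) → ℝ) := (Module.finBasis ℝ V).equivFun with heV
  refine ⟨Fintype.card ι, Module.finrank ℝ V,
    (Matrix.reindexLinearEquiv ℝ ℝ eι eι).toLinearMap ∘ₗ A ∘ₗ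
      (LinearMap.id.prodMap eV.symm.toLinearMap), Matrix.reindex eι eι B, fun x => ?_⟩
  rw [h]
  have key : ∀ y : V, ((Matrix.reindexLinearEquiv ℝ ℝ eι eι).toLinearMap ∘ₗ A ∘ₗ
      (LinearMap.id.prodMap eV.symm.toLinearMap)) (x, eV y) + Matrix.reindex eι eι B =
      (A (x, y) + B).submatrix eι.symm eι.symm := by
    intro y
    simp [Matrix.reindex_apply, Matrix.submatrix_add]
  constructor
  · rintro ⟨y, hy⟩
    exact ⟨eV y, by rw [key]; exact (posSemidef_submatrix_equiv eι.symm).2 hy⟩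
  · rintro ⟨y', hy'⟩
    refine ⟨eV.symm y', ?_⟩
    have := key (eV.symm y')
    rw [LinearEquiv.apply_symm_apply] at this
    rw [this] at hy'
    exact (posSemidef_submatrix_equiv eι.symm).1 hy'

/-- A lifted description by an LMI together with finitely many affine inequalities and equalities
gives a spectrahedral shadow (`1 × 1` blocks). [folklore] -/
theorem isSpectrahedralShadow_of_rep_constraints {ι V κ κ' : Type*} [Fintype ι] [Fintype κ]
    [Fintype κ'] [AddCommGroup V] [Module ℝ V] [Module.Finite ℝ V] {K : Set (σ → ℝ)}
    (A : ((σ → ℝ) × V) →ₗ[ℝ] Matrix ι ι ℝ) (B : Matrix ι ι ℝ)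
    (L : ((σ → ℝ) × V) →ₗ[ℝ] (κ → ℝ)) (β : κ → ℝ) (E : ((σ → ℝ) × V) →ₗ[ℝ] (κ' → ℝ))
    (γ : κ' → ℝ)
    (h : ∀ x, x ∈ K ↔ ∃ y : V, (A (x, y) + B).PosSemidef ∧ (∀ k, 0 ≤ L (x, y) k + β k) ∧
      E (x, y) = γ) :
    IsSpectrahedralShadow K := by
  classical
  let L' : ((σ → ℝ) × V) →ₗ[ℝ] (κ ⊕ (κ' ⊕ κ') → ℝ) := sumElimLin L (sumElimLin E (-E))
  let β' : κ ⊕ (κ' ⊕ κ') → ℝ := Sum.elim β (Sum.elim (-γ) γ)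
  refine isSpectrahedralShadow_of_rep (blockDiagLin A (diagLin L')) (fromBlocks B 0 0 (diagonal β'))
    fun x => ?_
  rw [h]
  refine exists_congr fun y => ?_
  simp only [blockDiagLin_apply, fromBlocks_add, add_zero, posSemidef_fromBlocks_zero_iff,
    diagLin_apply, diagonal_add, posSemidef_diagonal_iff]
  refine and_congr Iff.rfl ?_
  simp only [L', β', sumElimLin_apply, Sum.forall, Sum.elim_inl, Sum.elim_inr, LinearMap.neg_apply,
    Pi.neg_apply]
  constructor
  · rintro ⟨h1, h2⟩
    refine ⟨fun k => h1 k, fun k => ?_, fun k => ?_⟩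
    · rw [h2]; simp
    · rw [h2]; simp
  · rintro ⟨h1, h2, h3⟩
    refine ⟨fun k => h1 k, funext fun k => le_antisymm ?_ ?_⟩
    · have := h3 k; linarith
    · have := h2 k; linarith

/-- The empty set is a spectrahedral shadow. [folklore] -/
theorem isSpectrahedralShadow_empty : IsSpectrahedralShadow (∅ : Set (σ → ℝ)) := by
  refine ⟨1, 0, 0, -1, fun x => ?_⟩
  simp only [Set.mem_empty_iff_false, false_iff, not_exists, LinearMap.zero_apply, zero_add]
  intro y h
  have := h.diag_nonneg (i := 0)
  simp at this
  linarith

end Rep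

/-! ### Recession directions of bounded presentations -/

section Recession

variable {σ : Type*} [Fintype σ] {ι V : Type*} [AddCommGroup V] [Module ℝ V]

/-- **No recession directions for a bounded non-empty presented set**: if
`K = {x | ∃ y, A(x,y) + B ⪰ 0}` is bounded and non-empty and `A(x,y) ⪰ 0`, then `x = 0`
(Helton–Nie 2009, proof of Thm 2.2). [cite: HeltonNie2009, proof of Theorem 2.2] -/
theorem eq_zero_of_posSemidef_of_isBounded {K : Set (σ → ℝ)}
    (A : ((σ → ℝ) × V) →ₗ[ℝ] Matrix ι ι ℝ) (B : Matrix ι ι ℝ)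
    (h : ∀ x, x ∈ K ↔ ∃ y : V, (A (x, y) + B).PosSemidef) (hK : Bornology.IsBounded K)
    (hne : K.Nonempty) {x : σ → ℝ} {y : V} (hxy : (A (x, y)).PosSemidef) : x = 0 := by
  obtain ⟨x₀, hx₀⟩ := hne
  obtain ⟨y₀, hy₀⟩ := (h x₀).1 hx₀
  have hmem : ∀ t : ℕ, x₀ + (t : ℝ) • x ∈ K := by
    intro t
    refine (h _).2 ⟨y₀ + (t : ℝ) • y, ?_⟩
    have : A (x₀ + (t : ℝ) • x, y₀ + (t : ℝ) • y) + B = (A (x₀, y₀) + B) + (t : ℝ) • A (x, y) := by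
      rw [show (x₀ + (t : ℝ) • x, y₀ + (t : ℝ) • y) = (x₀, y₀) + (t : ℝ) • (x, y) by simp,
        map_add, map_smul]
      abel
    rw [this]
    exact hy₀.add (hxy.smul (Nat.cast_nonneg t))
  obtain ⟨R, hR⟩ := hK.exists_norm_le
  by_contra hx
  have hxpos : 0 < ‖x‖ := norm_pos_iff.2 hx
  obtain ⟨t, ht⟩ := exists_nat_gt ((R + ‖x₀‖) / ‖x‖)
  have h1 := hR _ (hmem t)
  have h2 : (t : ℝ) * ‖x‖ - ‖x₀‖ ≤ ‖x₀ + (t : ℝ) • x‖ := by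
    have := norm_sub_norm_le ((t : ℝ) • x) (-x₀)
    rw [norm_smul, Real.norm_eq_abs, abs_of_nonneg (Nat.cast_nonneg t), norm_neg,
      sub_neg_eq_add, add_comm] at this
    linarith
  rw [div_lt_iff₀ hxpos] at ht
  linarith

end Recession

/-! ### Closure properties -/

section ClosureProps

variable {σ τ : Type*}

/-- **Intersections** of spectrahedral shadows are spectrahedral shadows. [folklore] -/
theorem IsSpectrahedralShadow.inter {K₁ K₂ : Set (σ → ℝ)} (h₁ : IsSpectrahedralShadow K₁)
    (h₂ : IsSpectrahedralShadow K₂) : IsSpectrahedralShadow (K₁ ∩ K₂) := by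
  obtain ⟨m₁, p₁, A₁, B₁, h₁⟩ := h₁
  obtain ⟨m₂, p₂, A₂, B₂, h₂⟩ := h₂
  let π₁ : ((σ → ℝ) × ((Fin p₁ → ℝ) × (Fin p₂ → ℝ))) →ₗ[ℝ] ((σ → ℝ) × (Fin p₁ → ℝ)) :=
    LinearMap.id.prodMap (LinearMap.fst ℝ _ _)
  let π₂ : ((σ → ℝ) × ((Fin p₁ → ℝ) × (Fin p₂ → ℝ))) →ₗ[ℝ] ((σ → ℝ) × (Fin p₂ → ℝ)) :=
    LinearMap.id.prodMap (LinearMap.snd ℝ _ _)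
  refine isSpectrahedralShadow_of_rep (blockDiagLin (A₁ ∘ₗ π₁) (A₂ ∘ₗ π₂)) (fromBlocks B₁ 0 0 B₂)
    fun x => ?_
  simp only [Set.mem_inter_iff, h₁, h₂, blockDiagLin_apply, LinearMap.comp_apply, fromBlocks_add,
    add_zero, posSemidef_fromBlocks_zero_iff]
  constructor
  · rintro ⟨⟨y₁, hy₁⟩, ⟨y₂, hy₂⟩⟩
    exact ⟨(y₁, y₂), by simpa [π₁] using hy₁, by simpa [π₂] using hy₂⟩
  · rintro ⟨y, hy₁, hy₂⟩
    exact ⟨⟨y.1, by simpa [π₁] using hy₁⟩, ⟨y.2, by simpa [π₂] using hy₂⟩⟩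

/-- **Affine preimages** of spectrahedral shadows are spectrahedral shadows. [folklore] -/
theorem IsSpectrahedralShadow.affine_preimage {K : Set (σ → ℝ)} (hK : IsSpectrahedralShadow K)
    (f : (τ → ℝ) →ₗ[ℝ] (σ → ℝ)) (v : σ → ℝ) :
    IsSpectrahedralShadow ((fun x' => f x' + v) ⁻¹' K) := by
  obtain ⟨m, p, A, B, h⟩ := hK
  refine isSpectrahedralShadow_of_rep (A ∘ₗ (f.prodMap LinearMap.id)) (A (v, 0) + B) fun x' => ?_
  simp only [Set.mem_preimage, h, LinearMap.comp_apply, LinearMap.prodMap_apply, LinearMap.id_apply]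
  refine exists_congr fun y => ?_
  rw [show (f x' + v, y) = (f x', y) + (v, 0) by simp, map_add, add_assoc]

/-- **Affine images** of spectrahedral shadows are spectrahedral shadows. [folklore] -/
theorem IsSpectrahedralShadow.affine_image [Fintype σ] [Fintype τ] {K : Set (σ → ℝ)}
    (hK : IsSpectrahedralShadow K) (f : (σ → ℝ) →ₗ[ℝ] (τ → ℝ)) (v : τ → ℝ) :
    IsSpectrahedralShadow ((fun w => f w + v) '' K) := by
  obtain ⟨m, p, A, B, h⟩ := hK
  -- lifting space `(σ → ℝ) × (Fin p → ℝ)`; equality `x' - f w = v`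
  let A' : ((τ → ℝ) × ((σ → ℝ) × (Fin p → ℝ))) →ₗ[ℝ] Matrix (Fin m) (Fin m) ℝ :=
    A ∘ₗ LinearMap.snd ℝ _ _
  let E : ((τ → ℝ) × ((σ → ℝ) × (Fin p → ℝ))) →ₗ[ℝ] (τ → ℝ) :=
    LinearMap.fst ℝ _ _ - f ∘ₗ LinearMap.fst ℝ _ _ ∘ₗ LinearMap.snd ℝ _ _
  refine isSpectrahedralShadow_of_rep_constraints A' B (0 : _ →ₗ[ℝ] (Fin 0 → ℝ)) 0 E v fun x' => ?_
  simp only [Set.mem_image, h, A', E, LinearMap.comp_apply, LinearMap.snd_apply, LinearMap.fst_apply,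
    LinearMap.sub_apply, LinearMap.zero_apply, Pi.zero_apply, add_zero, le_refl, implies_true,
    true_and]
  constructor
  · rintro ⟨w, ⟨y, hy⟩, rfl⟩
    exact ⟨(w, y), hy, by simp⟩
  · rintro ⟨⟨w, y⟩, hy, hE⟩
    exact ⟨w, ⟨y, hy⟩, by rw [sub_eq_iff_eq_add] at hE; rw [hE]; abel⟩

/-- **Linear images** (special case). [folklore] -/
theorem IsSpectrahedralShadow.image [Fintype σ] [Fintype τ] {K : Set (σ → ℝ)}
    (hK : IsSpectrahedralShadow K)
    (f : (σ → ℝ) →ₗ[ℝ] (τ → ℝ)) : IsSpectrahedralShadow (f '' K) := by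
  simpa using hK.affine_image f 0

/-- **Translates**. [folklore] -/
theorem IsSpectrahedralShadow.vadd [Fintype σ] {K : Set (σ → ℝ)} (hK : IsSpectrahedralShadow K)
    (v : σ → ℝ) : IsSpectrahedralShadow ((fun w => w + v) '' K) := by
  simpa using hK.affine_image LinearMap.id v

/-- Singletons are spectrahedral shadows. [folklore] -/
theorem isSpectrahedralShadow_singleton [Fintype σ] (v : σ → ℝ) :
    IsSpectrahedralShadow ({v} : Set (σ → ℝ)) := by
  have h := (isSpectrahedralShadowOfSize_univ_zero (σ := Fin 0)).isSpectrahedralShadow.affine_image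
    (0 : (Fin 0 → ℝ) →ₗ[ℝ] (σ → ℝ)) v
  have : (fun w : Fin 0 → ℝ => (0 : (Fin 0 → ℝ) →ₗ[ℝ] (σ → ℝ)) w + v) '' Set.univ = {v} := by
    ext x; simp [eq_comm]
  rwa [this] at h

/-- **Conical hull** of a bounded non-empty spectrahedral shadow lying in an affine hyperplane
`{c = 1}` (Netzer–Sinn 2009, Prop. 2.1; homogenisation `A(x,y) + c(x) B ⪰ 0, c(x) ≥ 0`, using
`eq_zero_of_posSemidef_of_isBounded` at `c(x) = 0`). [cite: NetzerSinn2009, Proposition 2.1] -/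
theorem IsSpectrahedralShadow.coneOver [Fintype σ] {S : Set (σ → ℝ)} (hS : IsSpectrahedralShadow S)
    (hb : Bornology.IsBounded S) (hne : S.Nonempty) (c : (σ → ℝ) →ₗ[ℝ] ℝ) (hc : ∀ s ∈ S, c s = 1) :
    IsSpectrahedralShadow {x | ∃ t : ℝ, 0 ≤ t ∧ ∃ s ∈ S, x = t • s} := by
  obtain ⟨m, p, A, B, h⟩ := hS
  let A' : ((σ → ℝ) × (Fin p → ℝ)) →ₗ[ℝ] Matrix (Fin m) (Fin m) ℝ :=
    A + (c ∘ₗ LinearMap.fst ℝ _ _).smulRight B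
  let L : ((σ → ℝ) × (Fin p → ℝ)) →ₗ[ℝ] (Fin 1 → ℝ) :=
    LinearMap.pi fun _ => c ∘ₗ LinearMap.fst ℝ _ _
  refine isSpectrahedralShadow_of_rep_constraints A' 0 L 0 (0 : _ →ₗ[ℝ] (Fin 0 → ℝ)) 0 fun x => ?_
  simp only [Set.mem_setOf_eq, A', L, LinearMap.add_apply, LinearMap.smulRight_apply,
    LinearMap.comp_apply, LinearMap.fst_apply, add_zero, LinearMap.pi_apply, Pi.zero_apply,
    LinearMap.zero_apply, forall_const, and_true]
  constructor
  · rintro ⟨t, ht, s, hs, rfl⟩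
    obtain ⟨y, hy⟩ := (h s).1 hs
    refine ⟨t • y, ?_, by rw [map_smul, hc s hs]; simpa using ht⟩
    have : A (t • s, t • y) + c (t • s) • B = t • (A (s, y) + B) := by
      rw [map_smul, hc s hs, show (t • s, t • y) = t • (s, y) by rfl, map_smul, smul_add,
        smul_eq_mul, mul_one]
    rw [this]
    exact hy.smul ht
  · rintro ⟨y, hy, hcx⟩
    rcases hcx.eq_or_lt with h0 | hpos
    · -- `c x = 0`: recession direction
      rw [← h0, zero_smul, add_zero] at hy
      have hx : x = 0 := eq_zero_of_posSemidef_of_isBounded A B h hb hne hy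
      obtain ⟨s, hs⟩ := hne
      exact ⟨0, le_rfl, s, hs, by rw [hx, zero_smul]⟩
    · refine ⟨c x, hpos.le, (c x)⁻¹ • x, (h _).2 ⟨(c x)⁻¹ • y, ?_⟩, ?_⟩
      · have : A ((c x)⁻¹ • x, (c x)⁻¹ • y) + B = (c x)⁻¹ • (A (x, y) + c x • B) := by
          rw [show ((c x)⁻¹ • x, (c x)⁻¹ • y) = (c x)⁻¹ • (x, y) by rfl, map_smul, smul_add,
            smul_smul, inv_mul_cancel₀ hpos.ne', one_smul]
        rw [this]
        exact hy.smul (inv_nonneg.2 hpos.le)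
      · rw [smul_smul, mul_inv_cancel₀ hpos.ne', one_smul]

/-- `conv(s ∪ t) = conv(s ∪ conv t)`. [folklore] -/
theorem convexHull_union_convexHull_right (s t : Set (σ → ℝ)) :
    convexHull ℝ (s ∪ t) = convexHull ℝ (s ∪ convexHull ℝ t) := by
  refine Set.Subset.antisymm (convexHull_mono (Set.union_subset_union_right _ (subset_convexHull ℝ t)))
    (convexHull_min (Set.union_subset ((Set.subset_union_left).trans (subset_convexHull ℝ _))
      (convexHull_mono Set.subset_union_right)) (convex_convexHull ℝ _))

/-- **Convex hull of the union of two bounded convex non-empty spectrahedral shadows**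
(Helton–Nie 2009, Thm 2.2, two sets: `x = x₁ + x₂`, `A₁(x₁,y₁) + λB₁ ⪰ 0`,
`A₂(x₂,y₂) + (1-λ)B₂ ⪰ 0`, `0 ≤ λ ≤ 1`; exactness from `eq_zero_of_posSemidef_of_isBounded`).
[cite: HeltonNie2009, Theorem 2.2] -/
theorem IsSpectrahedralShadow.convexHull_union [Fintype σ] {W₁ W₂ : Set (σ → ℝ)}
    (h₁ : IsSpectrahedralShadow W₁) (h₂ : IsSpectrahedralShadow W₂)
    (hb₁ : Bornology.IsBounded W₁) (hb₂ : Bornology.IsBounded W₂) (hc₁ : Convex ℝ W₁)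
    (hc₂ : Convex ℝ W₂) (hn₁ : W₁.Nonempty) (hn₂ : W₂.Nonempty) :
    IsSpectrahedralShadow (convexHull ℝ (W₁ ∪ W₂)) := by
  obtain ⟨m₁, p₁, A₁, B₁, h₁⟩ := h₁
  obtain ⟨m₂, p₂, A₂, B₂, h₂⟩ := h₂
  -- the convex hull is the join
  have hset : ∀ x, x ∈ convexHull ℝ (W₁ ∪ W₂) ↔ ∃ a ∈ W₁, ∃ b ∈ W₂, ∃ θ : ℝ, 0 ≤ θ ∧ θ ≤ 1 ∧
      x = θ • a + (1 - θ) • b := by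
    intro x
    rw [_root_.convexHull_union hn₁ hn₂, hc₁.convexHull_eq, hc₂.convexHull_eq, mem_convexJoin]
    refine exists_congr fun a => and_congr Iff.rfl (exists_congr fun b => and_congr Iff.rfl ?_)
    rw [segment_eq_image, Set.mem_image]
    constructor
    · rintro ⟨θ, ⟨h0, h1⟩, rfl⟩
      exact ⟨1 - θ, by linarith, by linarith, by rw [sub_sub_cancel]⟩
    · rintro ⟨θ, h0, h1, rfl⟩
      exact ⟨1 - θ, ⟨by linarith, by linarith⟩, by rw [sub_sub_cancel]⟩
  -- total space: x : σ → ℝ; lifting ((θ, x₁), (y₁, y₂))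
  let Tot := (σ → ℝ) × ((ℝ × (σ → ℝ)) × ((Fin p₁ → ℝ) × (Fin p₂ → ℝ)))
  let lam : Tot →ₗ[ℝ] ℝ := LinearMap.fst ℝ _ _ ∘ₗ LinearMap.fst ℝ _ _ ∘ₗ LinearMap.snd ℝ _ _
  let x₁ : Tot →ₗ[ℝ] (σ → ℝ) := LinearMap.snd ℝ _ _ ∘ₗ LinearMap.fst ℝ _ _ ∘ₗ LinearMap.snd ℝ _ _
  let xx : Tot →ₗ[ℝ] (σ → ℝ) := LinearMap.fst ℝ _ _
  let y₁ : Tot →ₗ[ℝ] (Fin p₁ → ℝ) := LinearMap.fst ℝ _ _ ∘ₗ LinearMap.snd ℝ _ _ ∘ₗ LinearMap.snd ℝ _ _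
  let y₂ : Tot →ₗ[ℝ] (Fin p₂ → ℝ) := LinearMap.snd ℝ _ _ ∘ₗ LinearMap.snd ℝ _ _ ∘ₗ LinearMap.snd ℝ _ _
  let blk₁ : Tot →ₗ[ℝ] Matrix (Fin m₁) (Fin m₁) ℝ := A₁ ∘ₗ (x₁.prod y₁) + lam.smulRight B₁
  let blk₂ : Tot →ₗ[ℝ] Matrix (Fin m₂) (Fin m₂) ℝ := A₂ ∘ₗ ((xx - x₁).prod y₂) - lam.smulRight B₂
  let L : Tot →ₗ[ℝ] (Fin 2 → ℝ) := LinearMap.pi ![lam, -lam]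
  have key : ∀ (x : σ → ℝ) (θ : ℝ) (a' : σ → ℝ) (ya : Fin p₁ → ℝ) (yb : Fin p₂ → ℝ),
      blockDiagLin blk₁ blk₂ (x, ((θ, a'), (ya, yb))) + fromBlocks 0 0 0 B₂ =
        fromBlocks (A₁ (a', ya) + θ • B₁) 0 0 (A₂ (x - a', yb) - θ • B₂ + B₂) := by
    intro x θ a' ya yb
    rw [blockDiagLin_apply, fromBlocks_add]
    change fromBlocks (A₁ (a', ya) + θ • B₁ + 0) (0 + 0) (0 + 0) (A₂ (x - a', yb) - θ • B₂ + B₂) = _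
    simp only [add_zero]
  have keyL : ∀ (x : σ → ℝ) (θ : ℝ) (a' : σ → ℝ) (ya : Fin p₁ → ℝ) (yb : Fin p₂ → ℝ),
      (∀ k, 0 ≤ L (x, ((θ, a'), (ya, yb))) k + (![0, 1] : Fin 2 → ℝ) k) ↔ 0 ≤ θ ∧ θ ≤ 1 := by
    intro x θ a' ya yb
    rw [Fin.forall_fin_two]
    change (0 ≤ θ + 0 ∧ 0 ≤ -θ + 1) ↔ _
    constructor <;> rintro ⟨h0, h1⟩ <;> constructor <;> linarith
  refine isSpectrahedralShadow_of_rep_constraints (blockDiagLin blk₁ blk₂) (fromBlocks 0 0 0 B₂)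
    L ![0, 1] (0 : Tot →ₗ[ℝ] (Fin 0 → ℝ)) 0 fun x => ?_
  rw [hset]
  constructor
  · rintro ⟨a, ha, b, hb, θ, h0, h1, rfl⟩
    obtain ⟨ya, hya⟩ := (h₁ a).1 ha
    obtain ⟨yb, hyb⟩ := (h₂ b).1 hb
    refine ⟨((θ, θ • a), (θ • ya, (1 - θ) • yb)), ?_, (keyL _ _ _ _ _).2 ⟨h0, h1⟩,
      LinearMap.zero_apply _⟩
    rw [key, posSemidef_fromBlocks_zero_iff]
    constructor
    · have : A₁ (θ • a, θ • ya) + θ • B₁ = θ • (A₁ (a, ya) + B₁) := by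
        rw [show (θ • a, θ • ya) = θ • (a, ya) from rfl, map_smul, smul_add]
      rw [this]
      exact hya.smul h0
    · have : A₂ (θ • a + (1 - θ) • b - θ • a, (1 - θ) • yb) - θ • B₂ + B₂ =
          (1 - θ) • (A₂ (b, yb) + B₂) := by
        rw [add_sub_cancel_left, show ((1 - θ) • b, (1 - θ) • yb) = (1 - θ) • (b, yb) from rfl,
          map_smul]
        module
      rw [this]
      exact hyb.smul (by linarith)
  · rintro ⟨⟨⟨θ, a'⟩, ⟨ya, yb⟩⟩, hpsd, hL, -⟩
    rw [key, posSemidef_fromBlocks_zero_iff] at hpsd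
    obtain ⟨hA₁, hA₂⟩ := hpsd
    obtain ⟨h0, h1⟩ := (keyL _ _ _ _ _).1 hL
    rcases h0.eq_or_lt with rfl | hθpos
    · -- θ = 0 : a' = 0 by boundedness of W₁
      rw [zero_smul, add_zero] at hA₁
      have ha' : a' = 0 := eq_zero_of_posSemidef_of_isBounded A₁ B₁ h₁ hb₁ hn₁ hA₁
      obtain ⟨a, ha⟩ := hn₁
      refine ⟨a, ha, x, (h₂ x).2 ⟨yb, ?_⟩, 0, le_rfl, zero_le_one, by simp⟩
      simpa [ha'] using hA₂
    rcases h1.eq_or_lt with rfl | hθlt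
    · -- θ = 1 : x - a' = 0 by boundedness of W₂
      have hA₂' : (A₂ (x - a', yb)).PosSemidef := by simpa using hA₂
      have hxa : x - a' = 0 := eq_zero_of_posSemidef_of_isBounded A₂ B₂ h₂ hb₂ hn₂ hA₂'
      obtain ⟨b, hb⟩ := hn₂
      refine ⟨a', (h₁ a').2 ⟨ya, by simpa using hA₁⟩, b, hb, 1, zero_le_one, le_rfl, ?_⟩
      rw [sub_eq_zero] at hxa
      simp [hxa]
    · -- 0 < θ < 1
      have h1θ : (0 : ℝ) < 1 - θ := by linarith
      refine ⟨θ⁻¹ • a', (h₁ _).2 ⟨θ⁻¹ • ya, ?_⟩, (1 - θ)⁻¹ • (x - a'),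
        (h₂ _).2 ⟨(1 - θ)⁻¹ • yb, ?_⟩, θ, h0, h1, ?_⟩
      · have : A₁ (θ⁻¹ • a', θ⁻¹ • ya) + B₁ = θ⁻¹ • (A₁ (a', ya) + θ • B₁) := by
          rw [show (θ⁻¹ • a', θ⁻¹ • ya) = θ⁻¹ • (a', ya) from rfl, map_smul, smul_add, smul_smul,
            inv_mul_cancel₀ hθpos.ne', one_smul]
        rw [this]
        exact hA₁.smul (inv_nonneg.2 h0)
      · have : A₂ ((1 - θ)⁻¹ • (x - a'), (1 - θ)⁻¹ • yb) + B₂ =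
            (1 - θ)⁻¹ • (A₂ (x - a', yb) - θ • B₂ + B₂) := by
          rw [show ((1 - θ)⁻¹ • (x - a'), (1 - θ)⁻¹ • yb) = (1 - θ)⁻¹ • (x - a', yb) from rfl,
            map_smul, show A₂ (x - a', yb) - θ • B₂ + B₂ = A₂ (x - a', yb) + (1 - θ) • B₂ by module,
            smul_add, smul_smul, inv_mul_cancel₀ h1θ.ne', one_smul]
        rw [this]
        exact hA₂.smul (inv_nonneg.2 h1θ.le)
      · rw [smul_smul, mul_inv_cancel₀ hθpos.ne', one_smul, smul_smul,
          mul_inv_cancel₀ h1θ.ne', one_smul, add_sub_cancel]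

/-- **Convex hull of a finite union** of bounded convex non-empty spectrahedral shadows
(Helton–Nie 2009, Thm 2.2). [cite: HeltonNie2009, Theorem 2.2] -/
theorem IsSpectrahedralShadow.convexHull_biUnion [Fintype σ] {κ : Type*} (F : Finset κ)
    (W : κ → Set (σ → ℝ)) (h : ∀ i ∈ F, IsSpectrahedralShadow (W i))
    (hb : ∀ i ∈ F, Bornology.IsBounded (W i)) (hc : ∀ i ∈ F, Convex ℝ (W i))
    (hn : ∀ i ∈ F, (W i).Nonempty) :
    IsSpectrahedralShadow (convexHull ℝ (⋃ i ∈ F, W i)) := by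
  classical
  induction F using Finset.induction_on with
  | empty => simpa using (isSpectrahedralShadow_empty (σ := σ))
  | insert j F hj ih =>
      rw [Finset.set_biUnion_insert, convexHull_union_convexHull_right]
      by_cases hF : F = ∅
      · subst hF
        simpa [(hc j (Finset.mem_insert_self j _)).convexHull_eq] using h j (Finset.mem_insert_self j _)
      · have hF' : (⋃ i ∈ F, W i).Nonempty := by
          obtain ⟨i, hi⟩ := Finset.nonempty_iff_ne_empty.2 hF
          obtain ⟨w, hw⟩ := hn i (Finset.mem_insert_of_mem hi)
          exact ⟨w, Set.mem_biUnion hi hw⟩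
        refine IsSpectrahedralShadow.convexHull_union (h j (Finset.mem_insert_self j _))
          (ih (fun i hi => h i (Finset.mem_insert_of_mem hi)) (fun i hi => hb i (Finset.mem_insert_of_mem hi))
            (fun i hi => hc i (Finset.mem_insert_of_mem hi)) (fun i hi => hn i (Finset.mem_insert_of_mem hi)))
          (hb j (Finset.mem_insert_self j _)) ?_ (hc j (Finset.mem_insert_self j _))
          (convex_convexHull ℝ _) (hn j (Finset.mem_insert_self j _)) ?_
        · exact (isBounded_convexHull.2 (Bornology.isBounded_biUnion_finset F |>.2
            fun i hi => hb i (Finset.mem_insert_of_mem hi)))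
        · exact hF'.mono (subset_convexHull ℝ _)

end ClosureProps

end Literature.AlgebraicGeometry.HyperbolicPolynomials
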